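import Mathlib
import Literature.Analysis.SpecialFunctions.HypergeometricEulerTransformation
import Literature.NumberTheory.Transcendental.KZSliceFubini
import Literature.NumberTheory.Automorphic.GodementJacquetCenterMellin
import Summits.KontsevichZagierPeriods.Zeta5Search.RhinViolaGenerators
import Summits.KontsevichZagierPeriods.Zeta5Search.RhinViolaThetaComplex
import HarnessLib

/-!
# ζ(5) search — Rhin–Viola's `φ` and `χ` with COMPLEX exponents (cell `pub-zeta5`, seat ct-1 g12)

HONEST FRAMING: systematic search; no irrationality claim unless kernel-certified. Nothing in this file is an
irrationality result, a worthiness exponent or a denominator statement. `RhinViolaGenerators.lean` proves Rhin–Viola's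
hypergeometric move `φ` [G. Rhin, C. Viola, *The group structure for ζ(3)*, Acta Arith. 97 (2001), (4.1)] on the triple
integrals `T(h,l,k,s,j,q,c) = ∫_{(0,1)³} x^h(1−x)^l y^k(1−y)^s z^j(1−z)^q (1−(1−xy)z)^{−c}` for INTEGER exponents. On the
Bailey-free route to Brown–Zudilin's `h, h'` [BrownZudilin2022, Sect. 7] (memo `ct-1/g12/EULERSYM.md` §5) the third `φ` of the
word `φ ϑ φ σ φ χ` acts on COMPLEX `x`-exponents (`p₃+1+τ`, `q₃−p₆−1−τ`, `τ` the Mellin variable). Here: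

* `euler_symmetry_cpow` — the `₂F₁` parameter symmetry on Euler's integral with complex exponents and the homogeneous kernel
  `(α+βt)^{−a}`, `α > 0`, `α+β > 0`:
  `Γ(a)Γ(μ+ν+2−a) ∫₀¹ t^μ(1−t)^ν(α+βt)^{−a} = Γ(μ+1)Γ(ν+1) α^{μ+1−a} ∫₀¹ t^{a−1}(1−t)^{μ+ν+1−a}(α+βt)^{−(μ+1)}`
  — a corollary of the tree's `Hypergeometric.eulerHypergeometric_symm` (identity theorem on `Re z < 1`) at `z = −β/α`;
* `setIntegral_cube3_eq_of_slices_integrable` — Fubini along the first coordinate of `(0,1)³` for INTEGRABLE complex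
  integrands (`KZ.measurePreserving_vecCons`);
* **`rv_phi_cpow`** — `φ` with complex exponents:
  `Γ(c)Γ(h+l+2−c)·T(h,l,k,s,j,q,c) = Γ(h+1)Γ(l+1)·T(c−1, h+l+1−c, k, s, j, q+h+1−c, h+1)` for complex `h,l,k,s,j,q,c` with
  `Re h, Re l > −1`, `0 < Re c < Re(h+l+2)`, GIVEN the integrability of both integrands on the cube (hypotheses; on the route
  they are absolutely convergent Euler-type integrals);
* **`rv_chi_cpow`** — `χ` with complex exponents (the same in the variable `z`, kernel `1 − (1−xy)z`, after a cyclic permutation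
  of the cube): `Γ(c)Γ(j+q+2−c)·T(h,l,k,s,j,q,c) = Γ(j+1)Γ(q+1)·T(h,l,k,s,c−1,j+q+1−c,j+1)`, `Re j, Re q > −1`,
  `0 < Re c < Re(j+q+2)`, given integrability.

Theorems only (no new definitions).
-/

noncomputable section

namespace Summit.KontsevichZagierPeriods.Zeta5Search.RhinViolaGeneratorsComplex

open MeasureTheory Set Filter intervalIntegral
open Literature.Analysis.SpecialFunctions.Hypergeometric (eulerHypergeometric eulerIntegral eulerIntegrand
  eulerHypergeometric_symm)
open Literature.NumberTheory.Transcendental (KZ.measurePreserving_vecCons KZ.measurableEmbedding_vecCons)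
open Literature.NumberTheory.Automorphic (ofReal_cpow_eq_exp)
open Summit.KontsevichZagierPeriods.Zeta5Search.RhinViolaGenerators (mem_cube measurableSet_cube vecCons_mem_cube3_iff
  vecCons_preimage_cube3)
open Summit.KontsevichZagierPeriods.Zeta5Search.RhinViolaThetaComplex (setIntegral_cube3_perm')

/-! ### The `₂F₁` symmetry with complex exponents and the homogeneous kernel -/

/-- Euler's integrand at `z = w` real, `b = μ+1`, `c = μ+ν+2`, against the homogeneous kernel: for `t ∈ [0,1]`, `α > 0` and
`α + βt > 0`, `t^μ (1−t)^ν (α+βt)^{−a} = α^{−a} · eulerIntegrand a (μ+1) (μ+ν+2) (−β/α) t`. -/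
theorem kernel_eq_eulerIntegrand {α β : ℝ} (hα : 0 < α) (a μ ν : ℂ) {t : ℝ} (ht : 0 ≤ α + β * t) :
    (t : ℂ) ^ μ * ((1 - t : ℝ) : ℂ) ^ ν * ((α + β * t : ℝ) : ℂ) ^ (-a) =
      (α : ℂ) ^ (-a) * eulerIntegrand a (μ + 1) (μ + ν + 2) (((-β / α : ℝ)) : ℂ) t := by
  rw [eulerIntegrand, show μ + 1 - 1 = μ by ring, show μ + ν + 2 - (μ + 1) - 1 = ν by ring]
  have hsplit : ((α + β * t : ℝ) : ℂ) = ((α * (1 - -β / α * t) : ℝ) : ℂ) := by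
    congr 1; field_simp; ring
  have h1 : 0 ≤ 1 - -β / α * t := by
    have : α * (1 - -β / α * t) = α + β * t := by field_simp; ring
    nlinarith [this, hα, ht]
  rw [hsplit, Complex.ofReal_mul, Complex.mul_cpow_ofReal_nonneg hα.le h1]
  push_cast
  ring

/-- **The `₂F₁` parameter symmetry on Euler's integral, complex exponents, homogeneous kernel** (`α > 0`, `α + β > 0`,
`Re μ, Re ν > −1`, `0 < Re a < Re(μ+ν+2)`):
`Γ(a)Γ(μ+ν+2−a) ∫₀¹ t^μ(1−t)^ν(α+βt)^{−a} dt = Γ(μ+1)Γ(ν+1) α^{μ+1−a} ∫₀¹ t^{a−1}(1−t)^{μ+ν+1−a}(α+βt)^{−(μ+1)} dt`.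
[Hypergeometric.eulerHypergeometric_symm; DLMF 15.6.1] -/
theorem euler_symmetry_cpow {α β : ℝ} (hα : 0 < α) (hαβ : 0 < α + β) {μ ν a : ℂ} (hμ : -1 < μ.re) (hν : -1 < ν.re)
    (ha : 0 < a.re) (haμν : a.re < μ.re + ν.re + 2) :
    Complex.Gamma a * Complex.Gamma (μ + ν + 2 - a) *
        ∫ t in (0:ℝ)..1, (t : ℂ) ^ μ * ((1 - t : ℝ) : ℂ) ^ ν * ((α + β * t : ℝ) : ℂ) ^ (-a) =
      Complex.Gamma (μ + 1) * Complex.Gamma (ν + 1) * (α : ℂ) ^ (μ + 1 - a) *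
        ∫ t in (0:ℝ)..1, (t : ℂ) ^ (a - 1) * ((1 - t : ℝ) : ℂ) ^ (μ + ν + 1 - a) * ((α + β * t : ℝ) : ℂ) ^ (-(μ + 1)) := by
  have hpos : ∀ t ∈ uIcc (0:ℝ) 1, 0 ≤ α + β * t := by
    intro t ht
    rw [uIcc_of_le zero_le_one] at ht
    rcases le_or_gt 0 β with hb | hb
    · nlinarith [mul_nonneg hb ht.1]
    · nlinarith [mul_le_mul_of_nonpos_left ht.2 hb.le]
  set w : ℝ := -β / α with hw
  have hwre : ((w : ℂ)).re < 1 := by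
    rw [Complex.ofReal_re, hw, div_lt_one hα]; linarith
  have hb : 0 < (μ + 1).re := by simp; linarith
  have hbc : (μ + 1).re < (μ + ν + 2).re := by simp; linarith
  have hac : a.re < (μ + ν + 2).re := by simp; linarith
  have key := eulerHypergeometric_symm ha hac hb hbc hwre
  -- the two integrals as Euler integrals
  have hI₁ : ∫ t in (0:ℝ)..1, (t : ℂ) ^ μ * ((1 - t : ℝ) : ℂ) ^ ν * ((α + β * t : ℝ) : ℂ) ^ (-a) =
      (α : ℂ) ^ (-a) * eulerIntegral a (μ + 1) (μ + ν + 2) (w : ℂ) := by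
    rw [eulerIntegral, ← intervalIntegral.integral_const_mul]
    exact intervalIntegral.integral_congr fun t ht => kernel_eq_eulerIntegrand hα a μ ν (hpos t ht)
  have hI₂ : ∫ t in (0:ℝ)..1, (t : ℂ) ^ (a - 1) * ((1 - t : ℝ) : ℂ) ^ (μ + ν + 1 - a) *
        ((α + β * t : ℝ) : ℂ) ^ (-(μ + 1)) =
      (α : ℂ) ^ (-(μ + 1)) * eulerIntegral (μ + 1) a (μ + ν + 2) (w : ℂ) := by
    rw [eulerIntegral, ← intervalIntegral.integral_const_mul]
    refine intervalIntegral.integral_congr fun t ht => ?_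
    have e := kernel_eq_eulerIntegrand hα (μ + 1) (a - 1) (μ + ν + 1 - a) (hpos t ht)
    rw [show a - 1 + 1 = a by ring, show a - 1 + (μ + ν + 1 - a) + 2 = μ + ν + 2 by ring] at e
    exact e
  -- unpack the symmetry of the Euler hypergeometric functions
  have hGc : Complex.Gamma (μ + ν + 2) ≠ 0 := Complex.Gamma_ne_zero_of_re_pos (by simp; linarith)
  have hGa : Complex.Gamma a ≠ 0 := Complex.Gamma_ne_zero_of_re_pos ha
  have hGca : Complex.Gamma (μ + ν + 2 - a) ≠ 0 := Complex.Gamma_ne_zero_of_re_pos (by simp; linarith)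
  have hGb : Complex.Gamma (μ + 1) ≠ 0 := Complex.Gamma_ne_zero_of_re_pos hb
  have hGcb : Complex.Gamma (ν + 1) ≠ 0 := Complex.Gamma_ne_zero_of_re_pos (by simp; linarith)
  have hαc : (α : ℂ) ≠ 0 := by exact_mod_cast hα.ne'
  unfold eulerHypergeometric at key
  rw [show μ + ν + 2 - (μ + 1) = ν + 1 by ring] at key
  have key' : Complex.Gamma a * Complex.Gamma (μ + ν + 2 - a) * eulerIntegral a (μ + 1) (μ + ν + 2) (w : ℂ) =
      Complex.Gamma (μ + 1) * Complex.Gamma (ν + 1) * eulerIntegral (μ + 1) a (μ + ν + 2) (w : ℂ) := by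
    field_simp at key
    linear_combination key
  have hαα : (α : ℂ) ^ (μ + 1 - a) * (α : ℂ) ^ (-(μ + 1)) = (α : ℂ) ^ (-a) := by
    rw [← Complex.cpow_add _ _ hαc]; congr 1; ring
  rw [hI₁, hI₂]
  linear_combination (α : ℂ) ^ (-a) * key' -
    Complex.Gamma (μ + 1) * Complex.Gamma (ν + 1) * eulerIntegral (μ + 1) a (μ + ν + 2) (w : ℂ) * hαα

/-! ### Fubini along the first coordinate of `(0,1)³` for integrable complex integrands -/

/-- **Fubini slice lemma for integrable complex integrands**: if `F, G` are integrable on `(0,1)³` and their first-coordinate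
slice integrals are proportional, `c·∫F(s,x)ds = d·∫G(s,x)ds` for every `x ∈ (0,1)²`, then `c·∫F = d·∫G`. -/
theorem setIntegral_cube3_eq_of_slices_integrable {F G : (Fin 3 → ℝ) → ℂ}
    (hF : IntegrableOn F (univ.pi fun _ : Fin 3 => Ioo (0:ℝ) 1))
    (hG : IntegrableOn G (univ.pi fun _ : Fin 3 => Ioo (0:ℝ) 1)) {c d : ℂ}
    (h : ∀ x ∈ (univ.pi fun _ : Fin 2 => Ioo (0:ℝ) 1),
      c * ∫ s in Ioo (0:ℝ) 1, F (Matrix.vecCons s x) = d * ∫ s in Ioo (0:ℝ) 1, G (Matrix.vecCons s x)) :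
    c * ∫ y in (univ.pi fun _ : Fin 3 => Ioo (0:ℝ) 1), F y = d * ∫ y in (univ.pi fun _ : Fin 3 => Ioo (0:ℝ) 1), G y := by
  have hmp := (KZ.measurePreserving_vecCons (n := 2)).restrict_preimage_emb KZ.measurableEmbedding_vecCons
    (univ.pi fun _ : Fin 3 => Ioo (0:ℝ) 1)
  rw [vecCons_preimage_cube3, ← Measure.prod_restrict] at hmp
  have slice : ∀ {H : (Fin 3 → ℝ) → ℂ}, IntegrableOn H (univ.pi fun _ : Fin 3 => Ioo (0:ℝ) 1) →
      ∫ y in (univ.pi fun _ : Fin 3 => Ioo (0:ℝ) 1), H y =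
        ∫ x in (univ.pi fun _ : Fin 2 => Ioo (0:ℝ) 1), ∫ s in Ioo (0:ℝ) 1, H (Matrix.vecCons s x) := by
    intro H hH
    have hint : Integrable (fun p : ℝ × (Fin 2 → ℝ) => H (Matrix.vecCons p.1 p.2))
        ((volume.restrict (Ioo (0:ℝ) 1)).prod (volume.restrict (univ.pi fun _ : Fin 2 => Ioo (0:ℝ) 1))) :=
      (hmp.integrable_comp_emb KZ.measurableEmbedding_vecCons).mpr hH
    rw [← hmp.integral_comp KZ.measurableEmbedding_vecCons, integral_prod_symm _ hint]
  rw [slice hF, slice hG, ← MeasureTheory.integral_const_mul, ← MeasureTheory.integral_const_mul]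
  exact setIntegral_congr_fun (measurableSet_cube 2) fun x hx => h x hx

/-- A set integral over `(0,1)` as an interval integral (vector-valued). -/
theorem setIntegral_Ioo_eq_intervalIntegral' {E : Type*} [NormedAddCommGroup E] [NormedSpace ℝ E] (f : ℝ → E) :
    ∫ s in Ioo (0:ℝ) 1, f s = ∫ s in (0:ℝ)..1, f s := by
  rw [intervalIntegral.integral_of_le zero_le_one, integral_Ioc_eq_integral_Ioo]

/-! ### `φ` with complex exponents -/

/-- The first-coordinate slice of the complex RV integrand is an Euler kernel in `x₀` with `α = 1−z`, `β = yz`. -/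
theorem rv_slice (h l k s j q c : ℂ) (t : ℝ) (x : Fin 2 → ℝ) :
    ((Matrix.vecCons t x 0 : ℝ) : ℂ) ^ h * ((1 - Matrix.vecCons t x 0 : ℝ) : ℂ) ^ l * ((Matrix.vecCons t x 1 : ℝ) : ℂ) ^ k *
        ((1 - Matrix.vecCons t x 1 : ℝ) : ℂ) ^ s * ((Matrix.vecCons t x 2 : ℝ) : ℂ) ^ j *
        ((1 - Matrix.vecCons t x 2 : ℝ) : ℂ) ^ q /
        ((1 - (1 - Matrix.vecCons t x 0 * Matrix.vecCons t x 1) * Matrix.vecCons t x 2 : ℝ) : ℂ) ^ c =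
      (((x 0 : ℝ) : ℂ) ^ k * ((1 - x 0 : ℝ) : ℂ) ^ s * ((x 1 : ℝ) : ℂ) ^ j * ((1 - x 1 : ℝ) : ℂ) ^ q) *
        ((t : ℂ) ^ h * ((1 - t : ℝ) : ℂ) ^ l * (((1 - x 1) + x 0 * x 1 * t : ℝ) : ℂ) ^ (-c)) := by
  simp only [Matrix.cons_val_zero, Matrix.cons_val_one, Matrix.cons_val]
  rw [show (1 - (1 - t * x 0) * x 1 : ℝ) = (1 - x 1) + x 0 * x 1 * t by ring, Complex.cpow_neg, div_eq_mul_inv]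
  ring

/-- **Rhin–Viola's `φ` with complex exponents** [RV (4.1)]: for complex `h,l,k,s,j,q,c` with `Re h, Re l > −1`,
`0 < Re c < Re(h+l+2)`, and both integrands integrable on `(0,1)³`,
`Γ(c)Γ(h+l+2−c)·T(h,l,k,s,j,q,c) = Γ(h+1)Γ(l+1)·T(c−1, h+l+1−c, k, s, j, q+h+1−c, h+1)`. -/
theorem rv_phi_cpow (h l k s j q c : ℂ) (hh : -1 < h.re) (hl : -1 < l.re) (hc : 0 < c.re) (hchl : c.re < h.re + l.re + 2)
    (hF : IntegrableOn (fun x : Fin 3 → ℝ => ((x 0 : ℝ) : ℂ) ^ h * ((1 - x 0 : ℝ) : ℂ) ^ l * ((x 1 : ℝ) : ℂ) ^ k *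
      ((1 - x 1 : ℝ) : ℂ) ^ s * ((x 2 : ℝ) : ℂ) ^ j * ((1 - x 2 : ℝ) : ℂ) ^ q /
      ((1 - (1 - x 0 * x 1) * x 2 : ℝ) : ℂ) ^ c) (univ.pi fun _ : Fin 3 => Ioo (0:ℝ) 1))
    (hG : IntegrableOn (fun x : Fin 3 → ℝ => ((x 0 : ℝ) : ℂ) ^ (c - 1) * ((1 - x 0 : ℝ) : ℂ) ^ (h + l + 1 - c) *
      ((x 1 : ℝ) : ℂ) ^ k * ((1 - x 1 : ℝ) : ℂ) ^ s * ((x 2 : ℝ) : ℂ) ^ j * ((1 - x 2 : ℝ) : ℂ) ^ (q + h + 1 - c) /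
      ((1 - (1 - x 0 * x 1) * x 2 : ℝ) : ℂ) ^ (h + 1)) (univ.pi fun _ : Fin 3 => Ioo (0:ℝ) 1)) :
    Complex.Gamma c * Complex.Gamma (h + l + 2 - c) *
        ∫ x in (univ.pi fun _ : Fin 3 => Ioo (0:ℝ) 1), ((x 0 : ℝ) : ℂ) ^ h * ((1 - x 0 : ℝ) : ℂ) ^ l *
          ((x 1 : ℝ) : ℂ) ^ k * ((1 - x 1 : ℝ) : ℂ) ^ s * ((x 2 : ℝ) : ℂ) ^ j * ((1 - x 2 : ℝ) : ℂ) ^ q /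
          ((1 - (1 - x 0 * x 1) * x 2 : ℝ) : ℂ) ^ c =
      Complex.Gamma (h + 1) * Complex.Gamma (l + 1) *
        ∫ x in (univ.pi fun _ : Fin 3 => Ioo (0:ℝ) 1), ((x 0 : ℝ) : ℂ) ^ (c - 1) * ((1 - x 0 : ℝ) : ℂ) ^ (h + l + 1 - c) *
          ((x 1 : ℝ) : ℂ) ^ k * ((1 - x 1 : ℝ) : ℂ) ^ s * ((x 2 : ℝ) : ℂ) ^ j * ((1 - x 2 : ℝ) : ℂ) ^ (q + h + 1 - c) /
          ((1 - (1 - x 0 * x 1) * x 2 : ℝ) : ℂ) ^ (h + 1) := by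
  refine setIntegral_cube3_eq_of_slices_integrable hF hG fun x hx => ?_
  have hy := mem_cube hx 0; have hz := mem_cube hx 1
  have hα : 0 < 1 - x 1 := by linarith [hz.2]
  have hαβ : 0 < (1 - x 1) + x 0 * x 1 := by nlinarith [mul_pos hy.1 hz.1]
  simp_rw [rv_slice]
  rw [MeasureTheory.integral_const_mul, MeasureTheory.integral_const_mul, setIntegral_Ioo_eq_intervalIntegral',
    setIntegral_Ioo_eq_intervalIntegral']
  have hE := euler_symmetry_cpow hα hαβ (μ := h) (ν := l) (a := c) hh hl hc hchl
  have hα0 : ((1 - x 1 : ℝ) : ℂ) ≠ 0 := by exact_mod_cast hα.ne'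
  rw [show q + h + 1 - c = q + (h + 1 - c) by ring, Complex.cpow_add _ _ hα0]
  generalize (∫ t in (0:ℝ)..1, (t : ℂ) ^ h * ((1 - t : ℝ) : ℂ) ^ l * (((1 - x 1) + x 0 * x 1 * t : ℝ) : ℂ) ^ (-c)) = I₁
    at hE ⊢
  generalize (∫ t in (0:ℝ)..1, (t : ℂ) ^ (c - 1) * ((1 - t : ℝ) : ℂ) ^ (h + l + 1 - c) *
    (((1 - x 1) + x 0 * x 1 * t : ℝ) : ℂ) ^ (-(h + 1))) = I₂ at hE ⊢
  linear_combination (((x 0 : ℝ) : ℂ) ^ k * ((1 - x 0 : ℝ) : ℂ) ^ s * ((x 1 : ℝ) : ℂ) ^ j *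
    ((1 - x 1 : ℝ) : ℂ) ^ q) * hE

/-! ### `χ` with complex exponents -/

/-- Cyclic permutation of the cube for vector-valued integrands: `∫ g(x₁,x₂,x₀) = ∫ g`. -/
theorem setIntegral_cube3_rotate' {E : Type*} [NormedAddCommGroup E] [NormedSpace ℝ E] (g : (Fin 3 → ℝ) → E) :
    ∫ x in (univ.pi fun _ : Fin 3 => Ioo (0:ℝ) 1), g ![x 1, x 2, x 0] =
      ∫ x in (univ.pi fun _ : Fin 3 => Ioo (0:ℝ) 1), g x := by
  rw [← setIntegral_cube3_perm' (Equiv.swap 0 1 * Equiv.swap 1 2) g]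
  refine setIntegral_congr_fun (measurableSet_cube 3) fun x _ => ?_
  congr 1
  ext i; fin_cases i <;> simp [Equiv.swap_apply_def, Equiv.Perm.mul_apply]

/-- Integrability on the cube is invariant under the cyclic permutation `x ↦ (x₁,x₂,x₀)`. -/
theorem integrableOn_cube3_rotate {E : Type*} [NormedAddCommGroup E] (g : (Fin 3 → ℝ) → E)
    (hg : IntegrableOn g (univ.pi fun _ : Fin 3 => Ioo (0:ℝ) 1)) :
    IntegrableOn (fun x : Fin 3 → ℝ => g ![x 1, x 2, x 0]) (univ.pi fun _ : Fin 3 => Ioo (0:ℝ) 1) := by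
  let σ : Equiv.Perm (Fin 3) := Equiv.swap 0 1 * Equiv.swap 1 2
  let e : (Fin 3 → ℝ) ≃ᵐ (Fin 3 → ℝ) := MeasurableEquiv.piCongrLeft (fun _ : Fin 3 => ℝ) σ.symm
  have he : ∀ x : Fin 3 → ℝ, (e x : Fin 3 → ℝ) = ![x 1, x 2, x 0] := by
    intro x; ext i
    fin_cases i <;> simp [e, σ, MeasurableEquiv.coe_piCongrLeft, Equiv.piCongrLeft_apply_eq_cast, Equiv.swap_apply_def,
      Equiv.Perm.mul_apply]
  have hmp : MeasurePreserving e volume volume := volume_measurePreserving_piCongrLeft (fun _ : Fin 3 => ℝ) σ.symm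
  have hpre : e ⁻¹' (univ.pi fun _ : Fin 3 => Ioo (0:ℝ) 1) = (univ.pi fun _ : Fin 3 => Ioo (0:ℝ) 1) := by
    ext x
    simp only [Set.mem_preimage, he, mem_univ_pi, mem_Ioo]
    constructor
    · intro hx i
      fin_cases i
      · simpa using hx 2
      · simpa using hx 0
      · simpa using hx 1
    · intro hx i
      fin_cases i
      · simpa using hx 1
      · simpa using hx 2
      · simpa using hx 0
  have key := (hmp.integrableOn_comp_preimage e.measurableEmbedding).mpr hg
  rw [hpre] at key
  simpa only [Function.comp_def, he] using key

/-- The first-coordinate slice of the ROTATED complex RV integrand (`z` in front) is an Euler kernel in `z` with `α = 1`,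
`β = −(1−xy)`. -/
theorem rv_slice_rot (h l k s j q c : ℂ) (t : ℝ) (x : Fin 2 → ℝ) :
    ((Matrix.vecCons t x 1 : ℝ) : ℂ) ^ h * ((1 - Matrix.vecCons t x 1 : ℝ) : ℂ) ^ l * ((Matrix.vecCons t x 2 : ℝ) : ℂ) ^ k *
        ((1 - Matrix.vecCons t x 2 : ℝ) : ℂ) ^ s * ((Matrix.vecCons t x 0 : ℝ) : ℂ) ^ j *
        ((1 - Matrix.vecCons t x 0 : ℝ) : ℂ) ^ q /
        ((1 - (1 - Matrix.vecCons t x 1 * Matrix.vecCons t x 2) * Matrix.vecCons t x 0 : ℝ) : ℂ) ^ c =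
      (((x 0 : ℝ) : ℂ) ^ h * ((1 - x 0 : ℝ) : ℂ) ^ l * ((x 1 : ℝ) : ℂ) ^ k * ((1 - x 1 : ℝ) : ℂ) ^ s) *
        ((t : ℂ) ^ j * ((1 - t : ℝ) : ℂ) ^ q * ((1 + (-(1 - x 0 * x 1)) * t : ℝ) : ℂ) ^ (-c)) := by
  simp only [Matrix.cons_val_zero, Matrix.cons_val_one, Matrix.cons_val]
  rw [show (1 - (1 - x 0 * x 1) * t : ℝ) = 1 + (-(1 - x 0 * x 1)) * t by ring, Complex.cpow_neg, div_eq_mul_inv]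
  ring

/-- **Rhin–Viola's `χ` with complex exponents** [RV §4]: for complex `h,l,k,s,j,q,c` with `Re j, Re q > −1`,
`0 < Re c < Re(j+q+2)`, and both integrands integrable on `(0,1)³`,
`Γ(c)Γ(j+q+2−c)·T(h,l,k,s,j,q,c) = Γ(j+1)Γ(q+1)·T(h,l,k,s,c−1,j+q+1−c,j+1)`. -/
theorem rv_chi_cpow (h l k s j q c : ℂ) (hj : -1 < j.re) (hq : -1 < q.re) (hc : 0 < c.re) (hcjq : c.re < j.re + q.re + 2)
    (hF : IntegrableOn (fun x : Fin 3 → ℝ => ((x 0 : ℝ) : ℂ) ^ h * ((1 - x 0 : ℝ) : ℂ) ^ l * ((x 1 : ℝ) : ℂ) ^ k *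
      ((1 - x 1 : ℝ) : ℂ) ^ s * ((x 2 : ℝ) : ℂ) ^ j * ((1 - x 2 : ℝ) : ℂ) ^ q /
      ((1 - (1 - x 0 * x 1) * x 2 : ℝ) : ℂ) ^ c) (univ.pi fun _ : Fin 3 => Ioo (0:ℝ) 1))
    (hG : IntegrableOn (fun x : Fin 3 → ℝ => ((x 0 : ℝ) : ℂ) ^ h * ((1 - x 0 : ℝ) : ℂ) ^ l * ((x 1 : ℝ) : ℂ) ^ k *
      ((1 - x 1 : ℝ) : ℂ) ^ s * ((x 2 : ℝ) : ℂ) ^ (c - 1) * ((1 - x 2 : ℝ) : ℂ) ^ (j + q + 1 - c) /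
      ((1 - (1 - x 0 * x 1) * x 2 : ℝ) : ℂ) ^ (j + 1)) (univ.pi fun _ : Fin 3 => Ioo (0:ℝ) 1)) :
    Complex.Gamma c * Complex.Gamma (j + q + 2 - c) *
        ∫ x in (univ.pi fun _ : Fin 3 => Ioo (0:ℝ) 1), ((x 0 : ℝ) : ℂ) ^ h * ((1 - x 0 : ℝ) : ℂ) ^ l *
          ((x 1 : ℝ) : ℂ) ^ k * ((1 - x 1 : ℝ) : ℂ) ^ s * ((x 2 : ℝ) : ℂ) ^ j * ((1 - x 2 : ℝ) : ℂ) ^ q /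
          ((1 - (1 - x 0 * x 1) * x 2 : ℝ) : ℂ) ^ c =
      Complex.Gamma (j + 1) * Complex.Gamma (q + 1) *
        ∫ x in (univ.pi fun _ : Fin 3 => Ioo (0:ℝ) 1), ((x 0 : ℝ) : ℂ) ^ h * ((1 - x 0 : ℝ) : ℂ) ^ l *
          ((x 1 : ℝ) : ℂ) ^ k * ((1 - x 1 : ℝ) : ℂ) ^ s * ((x 2 : ℝ) : ℂ) ^ (c - 1) * ((1 - x 2 : ℝ) : ℂ) ^ (j + q + 1 - c) /
          ((1 - (1 - x 0 * x 1) * x 2 : ℝ) : ℂ) ^ (j + 1) := by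
  rw [← setIntegral_cube3_rotate' (fun x : Fin 3 → ℝ => ((x 0 : ℝ) : ℂ) ^ h * ((1 - x 0 : ℝ) : ℂ) ^ l *
      ((x 1 : ℝ) : ℂ) ^ k * ((1 - x 1 : ℝ) : ℂ) ^ s * ((x 2 : ℝ) : ℂ) ^ j * ((1 - x 2 : ℝ) : ℂ) ^ q /
      ((1 - (1 - x 0 * x 1) * x 2 : ℝ) : ℂ) ^ c),
    ← setIntegral_cube3_rotate' (fun x : Fin 3 → ℝ => ((x 0 : ℝ) : ℂ) ^ h * ((1 - x 0 : ℝ) : ℂ) ^ l *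
      ((x 1 : ℝ) : ℂ) ^ k * ((1 - x 1 : ℝ) : ℂ) ^ s * ((x 2 : ℝ) : ℂ) ^ (c - 1) * ((1 - x 2 : ℝ) : ℂ) ^ (j + q + 1 - c) /
      ((1 - (1 - x 0 * x 1) * x 2 : ℝ) : ℂ) ^ (j + 1))]
  have hF' := integrableOn_cube3_rotate _ hF
  have hG' := integrableOn_cube3_rotate _ hG
  simp only [Matrix.cons_val_zero, Matrix.cons_val_one, Matrix.cons_val] at hF' hG' ⊢
  refine setIntegral_cube3_eq_of_slices_integrable hF' hG' fun x hx => ?_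
  have hxx := mem_cube hx 0; have hyy := mem_cube hx 1
  have hαβ : 0 < (1:ℝ) + -(1 - x 0 * x 1) := by nlinarith [mul_pos hxx.1 hyy.1]
  simp_rw [rv_slice_rot]
  rw [MeasureTheory.integral_const_mul, MeasureTheory.integral_const_mul, setIntegral_Ioo_eq_intervalIntegral',
    setIntegral_Ioo_eq_intervalIntegral']
  have hE := euler_symmetry_cpow (α := 1) (β := -(1 - x 0 * x 1)) one_pos hαβ (μ := j) (ν := q) (a := c) hj hq hc hcjq
  rw [Complex.ofReal_one, Complex.one_cpow, mul_one] at hE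
  generalize (∫ t in (0:ℝ)..1, (t : ℂ) ^ j * ((1 - t : ℝ) : ℂ) ^ q * (((1:ℝ) + -(1 - x 0 * x 1) * t : ℝ) : ℂ) ^ (-c)) = I₁
    at hE ⊢
  generalize (∫ t in (0:ℝ)..1, (t : ℂ) ^ (c - 1) * ((1 - t : ℝ) : ℂ) ^ (j + q + 1 - c) *
    (((1:ℝ) + -(1 - x 0 * x 1) * t : ℝ) : ℂ) ^ (-(j + 1))) = I₂ at hE ⊢
  linear_combination (((x 0 : ℝ) : ℂ) ^ h * ((1 - x 0 : ℝ) : ℂ) ^ l * ((x 1 : ℝ) : ℂ) ^ k *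
    ((1 - x 1 : ℝ) : ℂ) ^ s) * hE

end Summit.KontsevichZagierPeriods.Zeta5Search.RhinViolaGeneratorsComplex

end
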